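import Summits.KontsevichZagierPeriods.KontsevichZagierPeriods.Theorems.RootDecompZetaThreeFrontierRungFourPreludeP08

/-! # `RootDecompZetaThreeFrontierRungFourPreludeP09` — part 9/14 of the mechanical ≤400-line split of `pre_src.lean` (sha256 ba362a5194d75c20…)
Source: decomp-kz lens-1 g12/g13 rung-4 prelude = Prelude_v3.lean @ba362a51 (Basis22_v1 sections RotFour/Shuffle/ProdFour/GenFb/WordMoves/RungFour/Basis22 + FacetGeneric_v2 §1–§23; critic CLEARED g6 row 330 / g6-20 l.1368); --supports stmt-KontsevichZagierPeriods-27141.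
Split by census-1 g10 `gen/splitlean.py`: scopes re-opened with their `open`/`variable`/`set_option` context; mathematics and declaration order unchanged. -/

set_option linter.dupNamespace false
open MeasureTheory Set
open Literature.NumberTheory.Transcendental
set_option linter.dupNamespace false
namespace Summit.KontsevichZagierPeriods.KontsevichZagierPeriods.Cruxes.GZNormalFormWThree.GZLadder.RungFour
open Summit.KontsevichZagierPeriods.KontsevichZagierPeriods.Cruxes.GZNormalFormWThree.GZLadder.FacetFour
  (not_integrableOn_of_residue)

/-- Auxiliary step `vec_refl`: vec refl. [bookkeeping] -/
theorem Chord.vec_refl {k : ℕ} (c : Chord k) (l : Fin (k + 1)) : c.refl.vec l = c.vec (Fin.rev l) := by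
  have hl := l.isLt
  have hi := c.i.isLt
  have hj := c.j.isLt
  have hlt : (c.i : ℕ) < c.j := c.lt
  unfold Chord.vec Chord.refl
  simp only [Fin.val_rev]
  by_cases h : (c.i : ℕ) ≤ k + 1 - (l + 1) ∧ k + 1 - (l + 1) < (c.j : ℕ)
  · rw [if_pos h, if_pos (by omega)]
  · rw [if_neg h, if_neg (by omega)]

/-- Auxiliary step `isFrame_reflFam`: is Frame refl Fam. [bookkeeping] -/
theorem isFrame_reflFam {k : ℕ} {S : Fin k → Chord k} (hS : IsFrame S) : IsFrame (reflFam S) := by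
  unfold IsFrame
  let Φ : (Fin (k + 1) → ℚ) →ₗ[ℚ] (Fin (k + 1) → ℚ) := LinearMap.funLeft ℚ ℚ (Fin.rev : Fin (k + 1) → Fin (k + 1))
  have hΦ : LinearMap.ker Φ = ⊥ :=
    LinearMap.ker_eq_bot.2 (LinearMap.funLeft_injective_of_surjective ℚ ℚ _ Fin.rev_surjective)
  have h := hS.map' Φ hΦ
  have e : Φ ∘ (Fin.cons (fun _ : Fin (k + 1) => (1 : ℚ)) (fun m => (S m).vec) : Fin (k + 1) → Fin (k + 1) → ℚ) =
      Fin.cons (fun _ : Fin (k + 1) => (1 : ℚ)) (fun m => (reflFam S m).vec) := by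
    funext m
    refine Fin.cases ?_ (fun m' => ?_) m
    · funext l; simp [Φ, LinearMap.funLeft_apply]
    · funext l; simp [Φ, LinearMap.funLeft_apply, reflFam, Chord.vec_refl]
  rwa [e] at h

/-- the reflected combination, re-indexed over the reflected frames -/
theorem sum_reflFam {k : ℕ} (F : Finset (Fin k → Chord k)) (q : (Fin k → Chord k) → ℚ) (t : Fin k → ℝ) :
    (∑ S ∈ F, (q S : ℝ) * ∏ m, 1 / (S m).form (reflPt k t)) =
      ∑ S' ∈ F.map ⟨reflFam, reflFam_injective⟩, (q (reflFam S') : ℝ) * ∏ m, 1 / (S' m).form t := by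
  rw [Finset.sum_map]
  refine Finset.sum_congr rfl fun S _ => ?_
  simp only [Function.Embedding.coeFn_mk, reflFam_reflFam, prod_form_reflPt]
  rfl

/-! ## §17 GENERIC TAIL-SCALING CHART (any `k = M+1`, any slot `j`): `T_j (p)_i = p_i (i ≤ j)`, `p_j · p_i (i > j)`,
a diffeomorphism `domT j → Δ_{M+1}` with `|Jac| = p_j ^ #{i | j < i}`; it realises the facets `{t_j, …, t_M, 0}`
(`p_j → 0`) for ALL `j` at once (instances: §9 `j = 0`, §6 `j = 1`, §10 `j = 2` for `k = 4`). -/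

section TailScale
variable {M : ℕ}

/-- the tail-scaling chart -/
def mapT (j : Fin (M + 1)) (p : Fin (M + 1) → ℝ) : Fin (M + 1) → ℝ :=
  fun i => if i ≤ j then p i else p j * p i

/-- its domain: all coordinates in `(0,1)`, head `(p_0 > … > p_j)` and tail `(p_{j+1} > … > p_M)` decreasing -/
def domT (j : Fin (M + 1)) : Set (Fin (M + 1) → ℝ) :=
  {p | (∀ i, 0 < p i ∧ p i < 1) ∧ (∀ i i', i < i' → i' ≤ j → p i' < p i) ∧ (∀ i i', i < i' → j < i → p i' < p i)}

/-- Auxiliary step `mapT_apply_of_le` (§17): map T apply of le. [bookkeeping] -/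
theorem mapT_apply_of_le {j i : Fin (M + 1)} (h : i ≤ j) (p : Fin (M + 1) → ℝ) : mapT j p i = p i := by
  simp [mapT, h]

/-- Auxiliary step `mapT_apply_of_lt` (§17): map T apply of lt. [bookkeeping] -/
theorem mapT_apply_of_lt {j i : Fin (M + 1)} (h : j < i) (p : Fin (M + 1) → ℝ) : mapT j p i = p j * p i := by
  simp [mapT, not_le.2 h]

/-- Auxiliary step `mapT_mem` (§17): map T mem. [bookkeeping] -/
theorem mapT_mem {j : Fin (M + 1)} {p : Fin (M + 1) → ℝ} (hp : p ∈ domT j) :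
    mapT j p ∈ KZ.openOrderedSimplex (M + 1) := by
  obtain ⟨h01, hh, ht⟩ := hp
  refine ⟨fun i => ?_, fun i => ?_, fun i i' hlt => ?_⟩
  · by_cases h : i ≤ j
    · rw [mapT_apply_of_le h]; exact (h01 i).1
    · rw [mapT_apply_of_lt (not_le.1 h)]; exact mul_pos (h01 j).1 (h01 i).1
  · by_cases h : i ≤ j
    · rw [mapT_apply_of_le h]; exact (h01 i).2
    · rw [mapT_apply_of_lt (not_le.1 h)]
      exact mul_lt_one_of_nonneg_of_lt_one_left (h01 j).1.le (h01 j).2 (h01 i).2.le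
  · show mapT j p i' < mapT j p i
    by_cases h' : i' ≤ j
    · rw [mapT_apply_of_le h', mapT_apply_of_le (hlt.le.trans h')]; exact hh i i' hlt h'
    · rw [mapT_apply_of_lt (not_le.1 h')]
      by_cases h : i ≤ j
      · rw [mapT_apply_of_le h]
        have hji : p j ≤ p i := by
          rcases h.lt_or_eq with h2 | h2
          · exact (hh i j h2 le_rfl).le
          · rw [h2]
        calc p j * p i' < p j * 1 := mul_lt_mul_of_pos_left (h01 i').2 (h01 j).1
          _ = p j := mul_one _
          _ ≤ p i := hji
      · rw [mapT_apply_of_lt (not_le.1 h)]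
        exact mul_lt_mul_of_pos_left (ht i i' hlt (not_le.1 h)) (h01 j).1

/-- inverse chart -/
noncomputable def invT (j : Fin (M + 1)) (t : Fin (M + 1) → ℝ) : Fin (M + 1) → ℝ :=
  fun i => if i ≤ j then t i else t i / t j

/-- Auxiliary step `invT_mem` (§17): inv T mem. [bookkeeping] -/
theorem invT_mem {j : Fin (M + 1)} {t : Fin (M + 1) → ℝ} (ht : t ∈ KZ.openOrderedSimplex (M + 1)) :
    invT j t ∈ domT j := by
  obtain ⟨h0, h1, ha⟩ := ht
  have hj0 : 0 < t j := h0 j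
  refine ⟨fun i => ?_, fun i i' hlt h' => ?_, fun i i' hlt h => ?_⟩
  · by_cases h : i ≤ j
    · simp only [invT, if_pos h]; exact ⟨h0 i, h1 i⟩
    · simp only [invT, if_neg h]
      exact ⟨div_pos (h0 i) hj0, by rw [div_lt_one hj0]; exact ha (not_le.1 h)⟩
  · simp only [invT, if_pos h', if_pos (hlt.le.trans h')]; exact ha hlt
  · simp only [invT, if_neg (not_le.2 h), if_neg (not_le.2 (h.trans hlt))]
    exact div_lt_div_of_pos_right (ha hlt) hj0

/-- Auxiliary step `mapT_invT` (§17): map T inv T. [bookkeeping] -/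
theorem mapT_invT {j : Fin (M + 1)} {t : Fin (M + 1) → ℝ} (ht : t ∈ KZ.openOrderedSimplex (M + 1)) :
    mapT j (invT j t) = t := by
  have hj : t j ≠ 0 := (ht.1 j).ne'
  funext i
  by_cases h : i ≤ j
  · simp [mapT, invT, h]
  · simp only [mapT, invT, if_neg h, if_pos le_rfl]
    field_simp

/-- Auxiliary step `invT_mapT` (§17): inv T map T. [bookkeeping] -/
theorem invT_mapT {j : Fin (M + 1)} {p : Fin (M + 1) → ℝ} (hp : p ∈ domT j) : invT j (mapT j p) = p := by
  have hj : p j ≠ 0 := (hp.1 j).1.ne'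
  funext i
  by_cases h : i ≤ j
  · simp [mapT, invT, h]
  · simp only [mapT, invT, if_neg h, if_pos le_rfl]
    field_simp

/-- Auxiliary step `image_mapT` (§17): image map T. [bookkeeping] -/
theorem image_mapT (j : Fin (M + 1)) : mapT j '' domT j = KZ.openOrderedSimplex (M + 1) := by
  ext t
  constructor
  · rintro ⟨p, hp, rfl⟩; exact mapT_mem hp
  · intro ht; exact ⟨invT j t, invT_mem ht, mapT_invT ht⟩

/-- Auxiliary step `injOn_mapT` (§17): inj On map T. [bookkeeping] -/
theorem injOn_mapT (j : Fin (M + 1)) : InjOn (mapT j) (domT j) :=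
  fun p hp q hq h => by rw [← invT_mapT hp, ← invT_mapT hq, h]

/-- Auxiliary step `isOpen_domT` (§17): is Open dom T. [bookkeeping] -/
theorem isOpen_domT (j : Fin (M + 1)) : IsOpen (domT j) := by
  have e : domT j = (⋂ i, {p : Fin (M + 1) → ℝ | 0 < p i} ∩ {p | p i < 1}) ∩
      (⋂ i, ⋂ i', {p : Fin (M + 1) → ℝ | i < i' → i' ≤ j → p i' < p i}) ∩
      (⋂ i, ⋂ i', {p : Fin (M + 1) → ℝ | i < i' → j < i → p i' < p i}) := by
    ext p; simp only [domT, Set.mem_setOf_eq, Set.mem_inter_iff, Set.mem_iInter]; exact and_assoc.symm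
  rw [e]
  refine ((isOpen_iInter_of_finite fun i => ?_).inter (isOpen_iInter_of_finite fun i =>
    isOpen_iInter_of_finite fun i' => ?_)).inter (isOpen_iInter_of_finite fun i => isOpen_iInter_of_finite fun i' => ?_)
  · exact (isOpen_lt continuous_const (continuous_apply i)).inter (isOpen_lt (continuous_apply i) continuous_const)
  · by_cases h : i < i' ∧ i' ≤ j
    · have : {p : Fin (M + 1) → ℝ | i < i' → i' ≤ j → p i' < p i} = {p | p i' < p i} := by
        ext p; simp only [Set.mem_setOf_eq]; exact ⟨fun hp => hp h.1 h.2, fun hp _ _ => hp⟩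
      rw [this]; exact isOpen_lt (continuous_apply i') (continuous_apply i)
    · have : {p : Fin (M + 1) → ℝ | i < i' → i' ≤ j → p i' < p i} = Set.univ := by
        ext p; simp only [Set.mem_setOf_eq, Set.mem_univ, iff_true]; exact fun h1 h2 => absurd ⟨h1, h2⟩ h
      rw [this]; exact isOpen_univ
  · by_cases h : i < i' ∧ j < i
    · have : {p : Fin (M + 1) → ℝ | i < i' → j < i → p i' < p i} = {p | p i' < p i} := by
        ext p; simp only [Set.mem_setOf_eq]; exact ⟨fun hp => hp h.1 h.2, fun hp _ _ => hp⟩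
      rw [this]; exact isOpen_lt (continuous_apply i') (continuous_apply i)
    · have : {p : Fin (M + 1) → ℝ | i < i' → j < i → p i' < p i} = Set.univ := by
        ext p; simp only [Set.mem_setOf_eq, Set.mem_univ, iff_true]; exact fun h1 h2 => absurd ⟨h1, h2⟩ h
      rw [this]; exact isOpen_univ

/-- coordinate projection (generic) -/
abbrev PjM (i : Fin (M + 1)) : (Fin (M + 1) → ℝ) →L[ℝ] ℝ :=
  ContinuousLinearMap.proj (R := ℝ) (φ := fun _ : Fin (M + 1) => ℝ) i

/-- derivative rows of `mapT` -/
def rowT (j : Fin (M + 1)) (p : Fin (M + 1) → ℝ) (i : Fin (M + 1)) : (Fin (M + 1) → ℝ) →L[ℝ] ℝ :=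
  if i ≤ j then PjM i else p j • PjM i + p i • PjM j

/-- Auxiliary definition `LT` (§17): LT. [bookkeeping] -/
def LT (j : Fin (M + 1)) (p : Fin (M + 1) → ℝ) : (Fin (M + 1) → ℝ) →L[ℝ] (Fin (M + 1) → ℝ) :=
  ContinuousLinearMap.pi (rowT j p)

/-- Auxiliary step `LT_apply` (§17): LT apply. [bookkeeping] -/
theorem LT_apply (j : Fin (M + 1)) (p h : Fin (M + 1) → ℝ) (i : Fin (M + 1)) : LT j p h i = rowT j p i h := rfl

/-- Auxiliary step `hasFDerivAt_mapT` (§17): has FDeriv At map T. [bookkeeping] -/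
theorem hasFDerivAt_mapT (j : Fin (M + 1)) (p : Fin (M + 1) → ℝ) : HasFDerivAt (mapT j) (LT j p) p := by
  refine hasFDerivAt_pi.2 fun i => ?_
  by_cases h : i ≤ j
  · have e : (fun q : Fin (M + 1) → ℝ => mapT j q i) = fun q => q i := funext fun q => mapT_apply_of_le h q
    rw [e]; simp only [rowT, if_pos h]
    exact hasFDerivAt_apply (𝕜 := ℝ) i p
  · have e : (fun q : Fin (M + 1) → ℝ => mapT j q i) = fun q => q j * q i :=
      funext fun q => mapT_apply_of_lt (not_le.1 h) q
    rw [e]; simp only [rowT, if_neg h]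
    exact (hasFDerivAt_apply (𝕜 := ℝ) j p).mul (hasFDerivAt_apply (𝕜 := ℝ) i p)

/-- the Jacobian matrix: lower triangular with diagonal `1` (i ≤ j) / `p j` (i > j) -/
def MT (j : Fin (M + 1)) (p : Fin (M + 1) → ℝ) : Matrix (Fin (M + 1)) (Fin (M + 1)) ℝ :=
  Matrix.of fun i l => if i ≤ j then (if l = i then 1 else 0) else (if l = i then p j else 0) + (if l = j then p i else 0)

/-- Auxiliary step `LT_eq_toLin'` (§17): LT eq to Lin'. [bookkeeping] -/
theorem LT_eq_toLin' (j : Fin (M + 1)) (p : Fin (M + 1) → ℝ) :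
    (LT j p : (Fin (M + 1) → ℝ) →ₗ[ℝ] (Fin (M + 1) → ℝ)) = Matrix.toLin' (MT j p) := by
  apply LinearMap.ext
  intro h
  rw [Matrix.toLin'_apply, ContinuousLinearMap.coe_coe]
  funext i
  rw [LT_apply]
  simp only [rowT, MT, Matrix.mulVec, dotProduct, Matrix.of_apply]
  by_cases hi : i ≤ j
  · simp only [if_pos hi, ite_mul, one_mul, zero_mul, Finset.sum_ite_eq', Finset.mem_univ, if_true]
    rfl
  · simp only [if_neg hi, add_mul, ite_mul, zero_mul, Finset.sum_add_distrib, Finset.sum_ite_eq', Finset.mem_univ,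
      if_true]
    simp only [add_apply, FunLike.coe_smul, Pi.smul_apply, smul_eq_mul]
    rfl

/-- Auxiliary step `MT_blockTriangular` (§17): MT block Triangular. [bookkeeping] -/
theorem MT_blockTriangular (j : Fin (M + 1)) (p : Fin (M + 1) → ℝ) :
    (MT j p).BlockTriangular OrderDual.toDual := by
  intro i l hlt
  have hlt' : i < l := hlt
  simp only [MT, Matrix.of_apply]
  by_cases hi : i ≤ j
  · rw [if_pos hi, if_neg hlt'.ne']
  · rw [if_neg hi, if_neg hlt'.ne', if_neg, add_zero]
    exact (lt_trans (not_le.1 hi) hlt').ne'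

/-- the number of tail coordinates `#{i | j < i}` (= `M − j`) -/
def tailCard (j : Fin (M + 1)) : ℕ := (Finset.univ.filter fun i : Fin (M + 1) => j < i).card

/-- Auxiliary step `tailCard_eq` (§17): tail Card eq. [bookkeeping] -/
theorem tailCard_eq (j : Fin (M + 1)) : tailCard j = M - j := by
  unfold tailCard
  rw [Finset.filter_lt_eq_Ioi, Fin.card_Ioi]
  omega

/-- Auxiliary step `det_MT` (§17): det MT. [bookkeeping] -/
theorem det_MT (j : Fin (M + 1)) (p : Fin (M + 1) → ℝ) : (MT j p).det = p j ^ tailCard j := by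
  rw [Matrix.det_of_lowerTriangular _ (MT_blockTriangular j p)]
  have e : ∀ i, MT j p i i = if j < i then p j else 1 := fun i => by
    simp only [MT, Matrix.of_apply, if_true]
    by_cases hi : i ≤ j
    · rw [if_pos hi, if_neg (not_lt.2 hi)]
    · rw [if_neg hi, if_pos (not_le.1 hi), if_neg (fun h => hi h.le), add_zero]
  simp only [e]
  rw [Finset.prod_ite, Finset.prod_const_one, mul_one, Finset.prod_const]
  rfl

/-- Auxiliary step `abs_det_LT` (§17): abs det LT. [bookkeeping] -/
theorem abs_det_LT {j : Fin (M + 1)} {p : Fin (M + 1) → ℝ} (hp : p ∈ domT j) : |(LT j p).det| = p j ^ tailCard j := by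
  have : (LT j p).det = p j ^ tailCard j := by
    show LinearMap.det (LT j p : (Fin (M + 1) → ℝ) →ₗ[ℝ] (Fin (M + 1) → ℝ)) = _
    rw [LT_eq_toLin', LinearMap.det_toLin', det_MT]
  rw [this, abs_of_pos (pow_pos (hp.1 j).1 _)]

/-- TRANSPORT through the tail-scaling chart (generic k, j) -/
theorem integrableOn_pullT_iff (j : Fin (M + 1)) (f : (Fin (M + 1) → ℝ) → ℝ) :
    IntegrableOn f (KZ.openOrderedSimplex (M + 1)) ↔
      IntegrableOn (fun p => f (mapT j p) * p j ^ tailCard j) (domT j) := by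
  rw [← image_mapT j, integrableOn_image_iff_integrableOn_abs_det_fderiv_smul (μ := volume)
    (isOpen_domT j).measurableSet (fun x _ => (hasFDerivAt_mapT j x).hasFDerivWithinAt) (injOn_mapT j) f]
  exact integrableOn_congr_fun (fun p hp => by rw [abs_det_LT hp, smul_eq_mul, mul_comm]) (isOpen_domT j).measurableSet

end TailScale

/-! ## §18 GENERIC TAIL FACETS `{t_j, …, t_M, 0}` (any `k = M+1`, any `j`): the residue of an integrable
frame combination along `p_j → 0` in the chart `T_j` vanishes on the open facet region `baseT j`
(head `x_0 > … > x_{j-1}` and tail `x_j > … > x_{M-1}` in `(0,1)`, independently).  This ONE theorem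
`facet_tail` replaces §6 (`j = 1`), §9 (`j = 0`), §10 (`j = 2`) of `k = 4` and gives the `k` tail facets of
every `Δ_k`; with §7 it also gives their `k` reflections `{1, t_0, …, t_{j'}}`. -/

section TailFacet
variable {M : ℕ}
set_option linter.unusedSimpArgs false

/-- Auxiliary step `insT_self` (§18): ins T self. [bookkeeping] -/
theorem insT_self (j : Fin (M + 1)) (a : ℝ) (x : Fin M → ℝ) : (Fin.insertNth j a x : Fin (M + 1) → ℝ) j = a := by
  simp

/-- Auxiliary step `insT_lt` (§18): ins T lt. [bookkeeping] -/
theorem insT_lt (j : Fin (M + 1)) (a : ℝ) (x : Fin M → ℝ) (i : Fin (M + 1)) (h : i < j) :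
    (Fin.insertNth j a x : Fin (M + 1) → ℝ) i = x ⟨i, by omega⟩ := by
  have h' : (i : ℕ) < j := h
  have e : j.succAbove ⟨i, by omega⟩ = i := by
    rw [Fin.succAbove_of_castSucc_lt j _ (Fin.lt_def.2 (by rw [Fin.val_castSucc]; exact h'))]; rfl
  have := Fin.insertNth_apply_succAbove (α := fun _ => ℝ) j a x ⟨i, by omega⟩
  rwa [e] at this

/-- Auxiliary step `insT_gt` (§18): ins T gt. [bookkeeping] -/
theorem insT_gt (j : Fin (M + 1)) (a : ℝ) (x : Fin M → ℝ) (i : Fin (M + 1)) (h : j < i) :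
    (Fin.insertNth j a x : Fin (M + 1) → ℝ) i = x ⟨i - 1, by omega⟩ := by
  have h' : (j : ℕ) < i := h
  have e : j.succAbove ⟨i - 1, by omega⟩ = i := by
    rw [Fin.succAbove_of_le_castSucc j _ (Fin.le_def.2 (by rw [Fin.val_castSucc]; simp only [Fin.val_mk]; omega))]
    ext; simp only [Fin.val_succ, Fin.val_mk]; omega
  have := Fin.insertNth_apply_succAbove (α := fun _ => ℝ) j a x ⟨i - 1, by omega⟩
  rwa [e] at this

/-- VALUE TABLE of the labelled points at `T_j (insertNth j a x)` -/
theorem xpt_mapT_insT (j : Fin (M + 1)) (a : ℝ) (x : Fin M → ℝ) (l : Fin (M + 3)) :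
    xpt (M + 1) (mapT j (Fin.insertNth j a x)) l =
      if h0 : (l : ℕ) = 0 then 1
      else if h1 : (l : ℕ) ≤ j then x ⟨(l : ℕ) - 1, by omega⟩
      else if h2 : (l : ℕ) = j + 1 then a
      else if h3 : (l : ℕ) ≤ M + 1 then a * x ⟨(l : ℕ) - 2, by omega⟩
      else 0 := by
  have hj := j.isLt
  unfold xpt
  by_cases h0 : (l : ℕ) = 0
  · simp [h0]
  rw [dif_neg h0, dif_neg h0]
  by_cases hl : (l : ℕ) ≤ M + 1
  · rw [dif_pos hl]
    by_cases h1 : (l : ℕ) ≤ j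
    · rw [dif_pos h1]
      have hlt : (j : ℕ) > (l : ℕ) - 1 := by omega
      have hlt' : (⟨(l : ℕ) - 1, by omega⟩ : Fin (M + 1)) < j := Fin.lt_def.2 (by simpa using hlt)
      rw [mapT_apply_of_le hlt'.le, insT_lt j a x _ hlt']
    rw [dif_neg h1]
    by_cases h2 : (l : ℕ) = j + 1
    · rw [dif_pos h2]
      have he : (⟨(l : ℕ) - 1, by omega⟩ : Fin (M + 1)) = j := Fin.ext (by simp only [Fin.val_mk]; omega)
      rw [he, mapT_apply_of_le le_rfl, insT_self]
    · rw [dif_neg h2, dif_pos hl]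
      have hgt : (j : ℕ) < (l : ℕ) - 1 := by omega
      have hgt' : j < (⟨(l : ℕ) - 1, by omega⟩ : Fin (M + 1)) := Fin.lt_def.2 (by simpa using hgt)
      rw [mapT_apply_of_lt hgt', insT_self, insT_gt j a x _ hgt']
      exact congrArg (a * ·) (congrArg x (Fin.ext (by simp only [Fin.val_mk]; omega)))
  · rw [dif_neg hl, dif_neg (by omega), dif_neg (by omega), dif_neg hl]

/-- scaled values of the cluster labels `l ≥ j+1` (a function of the base point only) -/
def ylabT (j : Fin (M + 1)) (x : Fin M → ℝ) (l : Fin (M + 3)) : ℝ :=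
  if (l : ℕ) = j + 1 then 1 else if h : (l : ℕ) ≤ M + 1 ∧ (j : ℕ) + 1 < l then x ⟨(l : ℕ) - 2, by omega⟩ else 0

/-- Auxiliary step `xpt_mapT_insT_of_cluster` (§18): xpt map T ins T of cluster. [bookkeeping] -/
theorem xpt_mapT_insT_of_cluster (j : Fin (M + 1)) (a : ℝ) (x : Fin M → ℝ) (l : Fin (M + 3))
    (hl : (j : ℕ) + 1 ≤ l) : xpt (M + 1) (mapT j (Fin.insertNth j a x)) l = a * ylabT j x l := by
  rw [xpt_mapT_insT]
  unfold ylabT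
  rw [dif_neg (by omega), dif_neg (by omega)]
  by_cases h2 : (l : ℕ) = j + 1
  · rw [dif_pos h2, if_pos h2, mul_one]
  rw [dif_neg h2, if_neg h2]
  by_cases h3 : (l : ℕ) ≤ M + 1
  · rw [dif_pos h3, dif_pos ⟨h3, by omega⟩]
  · rw [dif_neg h3, dif_neg (by omega), mul_zero]

/-- the REDUCED forms at `(x, a)`: cluster chords (`j+1 ≤ c.i`) ↦ `ylab c.i − ylab c.j`, others ↦ the form -/
noncomputable def redT (j : Fin (M + 1)) (c : Chord (M + 1)) (z : (Fin M → ℝ) × ℝ) : ℝ :=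
  if (j : ℕ) + 1 ≤ c.i then ylabT j z.1 c.i - ylabT j z.1 c.j else c.form (mapT j (Fin.insertNth j z.2 z.1))

/-- Auxiliary step `form_mapT_insT` (§18): form map T ins T. [bookkeeping] -/
theorem form_mapT_insT (j : Fin (M + 1)) (c : Chord (M + 1)) (x : Fin M → ℝ) (a : ℝ) :
    c.form (mapT j (Fin.insertNth j a x)) = (if (j : ℕ) + 1 ≤ c.i then a else 1) * redT j c (x, a) := by
  unfold redT
  by_cases h : (j : ℕ) + 1 ≤ c.i
  · rw [if_pos h, if_pos h]
    have hlt : (c.i : ℕ) < c.j := c.lt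
    simp only [Chord.form]
    rw [xpt_mapT_insT_of_cluster j a x c.i h, xpt_mapT_insT_of_cluster j a x c.j (by omega)]
    ring
  · rw [if_neg h, if_neg h, one_mul]

/-- the open facet region -/
def baseT (j : Fin (M + 1)) : Set (Fin M → ℝ) :=
  {x | (∀ i, 0 < x i ∧ x i < 1) ∧ (∀ i i' : Fin M, i < i' → (i' : ℕ) < j → x i' < x i) ∧
    (∀ i i' : Fin M, i < i' → (j : ℕ) ≤ i → x i' < x i)}

end TailFacet
end Summit.KontsevichZagierPeriods.KontsevichZagierPeriods.Cruxes.GZNormalFormWThree.GZLadder.RungFour
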